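import Literature.MathematicalPhysics.QuantumFieldTheory.Balaban1983to89.B3Sect3VectorSelfEnergy
import Literature.MathematicalPhysics.QuantumFieldTheory.Balaban1983to89.B3

/-!
# `Balaban1983to89.B3Resummation315` — T. Bałaban, *(Higgs)₂,₃ quantum fields in a finite volume. III. Renormalization*,
Commun. Math. Phys. **88** (1983) 411–445 [Balaban1983Higgs3], pp. 437, 439, 440: the three **"summation over orderings and
j-indices"** sentences of Sect. 3 — PROVED as the multilinearity of the graph expressions in their propagator kernels combined
with the multiscale decomposition (2.6) `G_k = Σ_{j=0}^{k−1} G^η_{(j)}`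

statement-level skeleton of published theorems with citation tags; proofs where landed; nothing here is a claim about the Yang–Mills mass gap

PDF held: `paper:balaban1983-higgs-2-3-quantum-fields-finite-volume` (journal page = PDF page + 410); pp. 437, 439, 440 [PDF 27, 29, 30]
read in the OCR text and on the ×4 renders `run/shared/lean/pub/pub-balaban/b2b-balaban-ref1/pages/1983-cmp88-higgs23-III/…-p026/p027-x4.png`.

CITATION HEADER (lean-in-tree rule).  Part of the lit-balaban TYPED SKELETON (HOME `run/shared/lean/pub/lit-balaban/`), PHASE 2, seat p20
generation 4.  WHAT IS REPRODUCED: rows **B3.Eq3.11-3.17** ((3.15)), **B3.Eq3.21-3.24** ((3.23)) and **B3.Eq3.25-3.32** ((3.26)) of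
`HOME/lit-balaban-r15/ROWS-B3.md` (fold owner r15), whose cells record *"the summation over orderings/indices itself — a statement
about the expansion — is not typed"* (`B3Sect3ScalarSelfEnergy.expr315`).  The expressions are r15's (`expr315`/`bracket315`/`coeff39`
p246479, `expr323`/`bracket323` p245397, `lhs326`/`bracket326`/`Pi2`/`Pi3` p245939); the decomposition (2.6) is r15's
`B3.Display26` (p239134; PROVED for every consistent renormalization-group tower and for the concrete torus tower by p14 g6,
`B3Eq26Tower.display26_tower`/`display26_torus`, p251304) and enters here, at the level of KERNELS on `T^{(j)}_η`, as the hypothesis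
`B3.Display26 G Gfam j₀` — i.e. `G = Σ_{j<j₀} Gfam j` for the kernel family `Gfam j = G^η_{(j)}` and the resummed propagator `G = G^η_{j₀}`.

THE PRINTED TEXT (verbatim).  p. 437: *"Let us consider the first expression on the right side of (3.11). The same expression appears
for all orderings of the lines of the graph G₀ with the only condition that they are earlier than the external lines. Making summations
over these orderings and indices means that we sum with respect to j, j′ from 0 to j″, where j″ is the lowest index of the external
lines. After the summations we get [(3.15)]"*.  p. 439: *"the second is treated in the same way as the expression (3.15): we sum over
proper orderings and j-indices and we get [(3.23)]"*.  p. 440: *"The remaining expressions are analyzed in the same way as the first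
term in (3.11). If j₀ denotes a smallest j-index of external legs, then we sum with respect to j, j′, j″ from 0 to j₀ and we get the same
expressions but with the propagator G_{j₀}(0)."*
WHAT IS PROVED, and how.  The graph expressions are MULTILINEAR in the kernels of their internal lines (each kernel enters once, through
the linear kernel operations `dKernel`/`d1Kernel`/`dAdjKernel`/`d2Kernel` or directly), so the double (resp. single) sum over the indices
of the internal lines of the expression built on the pieces `G^η_{(j)}`, `G^η_{(j′)}` equals the expression built on the summed propagators,
and with (2.6) these are `G^η_{j″}(0)`, `G^η_{j″}`: `expr315_resum` ((3.15); the first term of (3.11) with kernels `(Gj, Gj′)` IS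
`expr315 η q Gj Gj′ …`, `B3Sect3ScalarSelfEnergy.expr315_eq`), `expr323_resum` ((3.23)), `bracket326_resum`/`lhs326_resum`/`Pi2_resum`
((3.26), p. 440: two-line graphs summed over `(j, j′) ∈ [0,j₀)²`, one-line (local) graphs over `j″ ∈ [0,j₀)`, all three kernel slots
become `G_{j₀}(0)`), `Pi3_resum`/`curly1_resum`/`curly2_resum` (the curly brackets, two-line graphs only).  The admissibility
bookkeeping of the orderings (which (j, j′) occur; row B3.Eq2.7, `J(l̃)`) is NOT re-derived: the printed sentences assert that the
summation ranges over all `0 ≤ j, j′ < j″`, and that is the sum taken.  D-0026: theorems only, no `def`, no named fact; standard axioms.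
Unit `lit-balaban-p20` (literature-prover-lit-balaban-p20-g4-0), 2026-08-21.
-/

open scoped BigOperators RealInnerProductSpace

namespace Literature.MathematicalPhysics.QuantumFieldTheory.Balaban1983to89.B3Resummation315

open LatticeFieldCalculus B3Sect3ScalarSelfEnergy B3Sect3VectorSelfEnergy

noncomputable section

variable {P : Params} {j : ℕ}

/-! ## 0. Reordering finite sums -/

section Rot

variable {α β γ δ ι κ : Type*}

/-- kernel: move the outermost of three finite sums innermost. [folklore] -/
private theorem sum_rot3 (A : Finset α) (s : Finset ι) (t : Finset κ) (f : α → ι → κ → ℝ) :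
    ∑ a ∈ A, ∑ i ∈ s, ∑ i' ∈ t, f a i i' = ∑ i ∈ s, ∑ i' ∈ t, ∑ a ∈ A, f a i i' := by
  calc ∑ a ∈ A, ∑ i ∈ s, ∑ i' ∈ t, f a i i' = ∑ i ∈ s, ∑ a ∈ A, ∑ i' ∈ t, f a i i' := Finset.sum_comm
    _ = ∑ i ∈ s, ∑ i' ∈ t, ∑ a ∈ A, f a i i' := Finset.sum_congr rfl fun i _ => Finset.sum_comm

/-- kernel: move the two outermost of four finite sums innermost. [folklore] -/
private theorem sum_rot4 (A : Finset α) (B : Finset β) (s : Finset ι) (t : Finset κ) (f : α → β → ι → κ → ℝ) :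
    ∑ a ∈ A, ∑ b ∈ B, ∑ i ∈ s, ∑ i' ∈ t, f a b i i' = ∑ i ∈ s, ∑ i' ∈ t, ∑ a ∈ A, ∑ b ∈ B, f a b i i' := by
  calc ∑ a ∈ A, ∑ b ∈ B, ∑ i ∈ s, ∑ i' ∈ t, f a b i i'
      = ∑ a ∈ A, ∑ i ∈ s, ∑ i' ∈ t, ∑ b ∈ B, f a b i i' := Finset.sum_congr rfl fun a _ => sum_rot3 B s t (f a)
    _ = ∑ i ∈ s, ∑ i' ∈ t, ∑ a ∈ A, ∑ b ∈ B, f a b i i' := sum_rot3 A s t fun a i i' => ∑ b ∈ B, f a b i i'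

/-- kernel: `Σ_a c·Σ_b Σ_i f = Σ_i Σ_a c·Σ_b f` (a family index pulled out of a weighted double sum). [folklore] -/
private theorem sum_mul_sum_rot (c : ℝ) (A : Finset α) (B : Finset β) (s : Finset ι) (f : α → β → ι → ℝ) :
    ∑ a ∈ A, c * ∑ b ∈ B, ∑ i ∈ s, f a b i = ∑ i ∈ s, ∑ a ∈ A, c * ∑ b ∈ B, f a b i := by
  calc ∑ a ∈ A, c * ∑ b ∈ B, ∑ i ∈ s, f a b i = ∑ a ∈ A, ∑ i ∈ s, c * ∑ b ∈ B, f a b i :=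
        Finset.sum_congr rfl fun a _ => by rw [Finset.sum_comm, Finset.mul_sum]
    _ = ∑ i ∈ s, ∑ a ∈ A, c * ∑ b ∈ B, f a b i := Finset.sum_comm

/-- kernel: `Σ_a Σ_{a′} c·Σ_m Σ_{m′} Σ_i f = Σ_i Σ_a Σ_{a′} c·Σ_m Σ_{m′} f` (a family index pulled out of the pairing of (3.26)).
[folklore] -/
private theorem sum2_mul_sum2_rot (c : ℝ) (A : Finset α) (B : Finset β) (M : Finset γ) (M' : Finset δ) (s : Finset ι)
    (f : α → β → γ → δ → ι → ℝ) :
    ∑ a ∈ A, ∑ b ∈ B, c * ∑ m ∈ M, ∑ m' ∈ M', ∑ i ∈ s, f a b m m' i =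
      ∑ i ∈ s, ∑ a ∈ A, ∑ b ∈ B, c * ∑ m ∈ M, ∑ m' ∈ M', f a b m m' i := by
  calc ∑ a ∈ A, ∑ b ∈ B, c * ∑ m ∈ M, ∑ m' ∈ M', ∑ i ∈ s, f a b m m' i
      = ∑ a ∈ A, ∑ b ∈ B, ∑ i ∈ s, c * ∑ m ∈ M, ∑ m' ∈ M', f a b m m' i :=
        Finset.sum_congr rfl fun a _ => Finset.sum_congr rfl fun b _ => by
          rw [← sum_rot3 s M M' fun i m m' => f a b m m' i, Finset.mul_sum]
    _ = ∑ i ∈ s, ∑ a ∈ A, ∑ b ∈ B, c * ∑ m ∈ M, ∑ m' ∈ M', f a b m m' i :=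
        (sum_rot3 s A B fun i a b => c * ∑ m ∈ M, ∑ m' ∈ M', f a b m m' i).symm

end Rot

/-! ## 1. Linearity of the kernel operations in the propagator -/

section KernelOps

variable {ι : Type*} (s : Finset ι)

/-- kernel: a finite sum of kernels evaluated at a pair of sites. [folklore] -/
private theorem sum_kernel_apply (G : ι → Kernel P j) (x x' : Site P j) :
    (∑ i ∈ s, G i) x x' = ∑ i ∈ s, G i x x' := by
  rw [Finset.sum_apply, Finset.sum_apply]

/-- The kernel `(∂^η_μG∂^{η*}_μ)(x,x′)` of (3.9) is additive over a finite family of propagators `G = Σ_i G_i`.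
[cite: Balaban1983Higgs3, (3.15) p.437] -/
theorem dKernel_finset_sum (c : ℝ) (μ : Fin P.d) (G : ι → Kernel P j) (x x' : Site P j) :
    dKernel c μ (∑ i ∈ s, G i) x x' = ∑ i ∈ s, dKernel c μ (G i) x x' := by
  simp only [dKernel, sum_kernel_apply, Finset.mul_sum, ← Finset.sum_sub_distrib, ← Finset.sum_add_distrib]

/-- The kernel `(∂^η_μG)(x,x′)` of (3.23) is additive over a finite family of propagators. [cite: Balaban1983Higgs3, (3.23) p.439] -/
theorem d1Kernel_finset_sum (c : ℝ) (μ : Fin P.d) (G : ι → Kernel P j) (x x' : Site P j) :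
    d1Kernel c μ (∑ i ∈ s, G i) x x' = ∑ i ∈ s, d1Kernel c μ (G i) x x' := by
  simp only [d1Kernel, sum_kernel_apply, Finset.mul_sum, ← Finset.sum_sub_distrib]

/-- The kernel `(G∂^{η*}_μ)(x,x′)` of (3.26) is additive over a finite family of propagators. [cite: Balaban1983Higgs3, (3.26) p.440] -/
theorem dAdjKernel_finset_sum (c : ℝ) (μ : Fin P.d) (G : ι → Kernel P j) (x x' : Site P j) :
    dAdjKernel c μ (∑ i ∈ s, G i) x x' = ∑ i ∈ s, dAdjKernel c μ (G i) x x' := by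
  simp only [dAdjKernel, sum_kernel_apply, Finset.mul_sum, ← Finset.sum_sub_distrib]

/-- The kernel `(∂^η_{μ′}G∂^{η*}_μ)(x,x′)` of (3.26) is additive over a finite family of propagators. [cite: Balaban1983Higgs3, (3.26) p.440] -/
theorem d2Kernel_finset_sum (c : ℝ) (μ' μ : Fin P.d) (G : ι → Kernel P j) (x x' : Site P j) :
    d2Kernel c μ' μ (∑ i ∈ s, G i) x x' = ∑ i ∈ s, d2Kernel c μ' μ (G i) x x' := by
  simp only [d2Kernel, sum_kernel_apply, Finset.mul_sum, ← Finset.sum_sub_distrib, ← Finset.sum_add_distrib]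

end KernelOps

/-! ## 2. (3.15): the first term of (3.11) summed over j, j′ < j″ -/

section Eq315

variable {ι κ : Type*} (s : Finset ι) (t : Finset κ)
variable {W : Type*} [NormedAddCommGroup W] [InnerProductSpace ℝ W]

/-- The coefficient of (3.9)/(3.11) is bilinear in the two propagators: for `G₀ = Σ_i G₀ᵢ`, `G = Σ_{i′} G_{i′}`,
`c[G₀,G](x,x′) = Σ_i Σ_{i′} c[G₀ᵢ, G_{i′}](x,x′)`. [cite: Balaban1983Higgs3, (3.15) p.437] -/
theorem coeff39_sum_sum (η : ℝ) (G0 : ι → Kernel P j) (G : κ → Kernel P j) (g g' : SiteField P j ℝ) (x x' : Site P j) :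
    coeff39 η (∑ i ∈ s, G0 i) (∑ i' ∈ t, G i') g g' x x' = ∑ i ∈ s, ∑ i' ∈ t, coeff39 η (G0 i) (G i') g g' x x' := by
  simp only [coeff39, dKernel_finset_sum, sum_kernel_apply]
  rw [Finset.sum_comm (s := Finset.univ) (t := s), Finset.sum_mul, Finset.sum_mul_sum, Finset.sum_mul]
  exact Finset.sum_congr rfl fun i _ => Finset.sum_mul _ _ _

/-- The square bracket of (3.15) is bilinear in the two propagators. [cite: Balaban1983Higgs3, (3.15) p.437] -/
theorem bracket315_sum_sum (η : ℝ) (G0 : ι → Kernel P j) (G : κ → Kernel P j) (g g' : SiteField P j ℝ)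
    (dx : Fin P.d → Site P j → Site P j → ℝ) (μ : Fin P.d) (x : Site P j) :
    bracket315 η (∑ i ∈ s, G0 i) (∑ i' ∈ t, G i') g g' dx μ x = ∑ i ∈ s, ∑ i' ∈ t, bracket315 η (G0 i) (G i') g g' dx μ x := by
  unfold bracket315
  rw [← sum_rot3 Finset.univ s t]
  refine Finset.sum_congr rfl fun x' _ => ?_
  rw [coeff39_sum_sum, Finset.sum_mul, Finset.mul_sum]
  exact Finset.sum_congr rfl fun i _ => by rw [Finset.sum_mul, Finset.mul_sum]

/-- The expression (3.15) (= the first term of (3.11), `B3Sect3ScalarSelfEnergy.expr315_eq`) is bilinear in the two propagators: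
with the kernel families `G₀ᵢ`, `G_{i′}` in its two slots, the double sum of the expressions is the expression of the summed kernels.
[cite: Balaban1983Higgs3, (3.15) p.437] -/
theorem expr315_sum_sum (η : ℝ) (q : W →ₗ[ℝ] W) (G0 : ι → Kernel P j) (G : κ → Kernel P j) (g g' : SiteField P j ℝ)
    (dx : Fin P.d → Site P j → Site P j → ℝ) (φ : SiteField P j W) (D : Fin P.d → SiteField P j W) :
    ∑ i ∈ s, ∑ i' ∈ t, expr315 η q (G0 i) (G i') g g' dx φ D = expr315 η q (∑ i ∈ s, G0 i) (∑ i' ∈ t, G i') g g' dx φ D := by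
  have key : ∀ (μ : Fin P.d) (x : Site P j),
      η ^ P.d * (bracket315 η (∑ i ∈ s, G0 i) (∑ i' ∈ t, G i') g g' dx μ x * ⟪φ x, q (q (D μ x))⟫) =
        ∑ i ∈ s, ∑ i' ∈ t, η ^ P.d * (bracket315 η (G0 i) (G i') g g' dx μ x * ⟪φ x, q (q (D μ x))⟫) := by
    intro μ x
    rw [bracket315_sum_sum, Finset.sum_mul, Finset.mul_sum]
    exact Finset.sum_congr rfl fun i _ => by rw [Finset.sum_mul, Finset.mul_sum]
  unfold expr315
  simp only [key, Finset.sum_neg_distrib]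
  rw [sum_rot4 Finset.univ Finset.univ s t]

/-- **(3.15) p. 437 [PDF 27] — the summation over orderings and indices, PROVED**: *"Making summations over these orderings and
indices means that we sum with respect to j, j′ from 0 to j″, where j″ is the lowest index of the external lines. After the summations
we get (3.15)"*.  With the multiscale decomposition (2.6) of the two propagators on `T_η` at the level of kernels — `G^η_{j″}(0) =
Σ_{j<j″}G^η_{(j)}(0)` (`h0`) and `G^η_{j″} = Σ_{j′<j″}G^η_{(j′)}` (`h`), r15's `B3.Display26` — the first term of (3.11) (`eq311`, which
for the kernels `(G_{(j)}(0), G_{(j′)})` is `expr315 η q (G0fam j) (Gfam j′) …` by `expr315_eq`) summed over `0 ≤ j, j′ < j″` equals (3.15)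
with both propagators at the index j″. [cite: Balaban1983Higgs3, (3.15) p.437] -/
theorem expr315_resum (η : ℝ) (q : W →ₗ[ℝ] W) {j'' : ℕ} {G0 G : Kernel P j} {G0fam Gfam : ℕ → Kernel P j}
    (h0 : B3.Display26 G0 G0fam j'') (h : B3.Display26 G Gfam j'') (g g' : SiteField P j ℝ)
    (dx : Fin P.d → Site P j → Site P j → ℝ) (φ : SiteField P j W) (D : Fin P.d → SiteField P j W) :
    ∑ i ∈ Finset.range j'', ∑ i' ∈ Finset.range j'', expr315 η q (G0fam i) (Gfam i') g g' dx φ D =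
      expr315 η q G0 G g g' dx φ D := by
  rw [expr315_sum_sum, ← h0, ← h]

end Eq315

/-! ## 3. (3.23): the second graph of (3.22) summed over orderings and j-indices -/

section Eq323

variable {ι κ : Type*} (s : Finset ι) (t : Finset κ)
variable {W : Type*} [NormedAddCommGroup W] [InnerProductSpace ℝ W]

/-- The square bracket of (3.23) is bilinear in its two propagator slots (`∂^η_μG^η(0)` and `G^η`). [cite: Balaban1983Higgs3, (3.23) p.439] -/
theorem bracket323_sum_sum (η : ℝ) (μ : Fin P.d) (G0 : ι → Kernel P j) (G : κ → Kernel P j) (g g' : SiteField P j ℝ)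
    (x : Site P j) :
    bracket323 η μ (∑ i ∈ s, G0 i) (∑ i' ∈ t, G i') g g' x = ∑ i ∈ s, ∑ i' ∈ t, bracket323 η μ (G0 i) (G i') g g' x := by
  unfold bracket323
  rw [← sum_rot3 Finset.univ s t]
  refine Finset.sum_congr rfl fun x' _ => ?_
  rw [d1Kernel_finset_sum, sum_kernel_apply, Finset.sum_mul, Finset.sum_mul_sum, Finset.sum_mul, Finset.mul_sum]
  exact Finset.sum_congr rfl fun i _ => by rw [Finset.sum_mul, Finset.mul_sum]

/-- The expression (3.23) is bilinear in its two propagator slots. [cite: Balaban1983Higgs3, (3.23) p.439] -/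
theorem expr323_sum_sum (η : ℝ) (q : W →ₗ[ℝ] W) (G0 : ι → Kernel P j) (G : κ → Kernel P j) (g g' : SiteField P j ℝ)
    (φ φ' : SiteField P j W) :
    ∑ i ∈ s, ∑ i' ∈ t, expr323 η q (G0 i) (G i') g g' φ φ' = expr323 η q (∑ i ∈ s, G0 i) (∑ i' ∈ t, G i') g g' φ φ' := by
  have key : ∀ (μ : Fin P.d) (x : Site P j),
      η ^ P.d * (bracket323 η μ (∑ i ∈ s, G0 i) (∑ i' ∈ t, G i') g g' x * ⟪φ x, q (q (pdiff η⁻¹ μ φ' x))⟫) =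
        ∑ i ∈ s, ∑ i' ∈ t, η ^ P.d * (bracket323 η μ (G0 i) (G i') g g' x * ⟪φ x, q (q (pdiff η⁻¹ μ φ' x))⟫) := by
    intro μ x
    rw [bracket323_sum_sum, Finset.sum_mul, Finset.mul_sum]
    exact Finset.sum_congr rfl fun i _ => by rw [Finset.sum_mul, Finset.mul_sum]
  unfold expr323
  simp only [key]
  rw [sum_rot4 Finset.univ Finset.univ s t]

/-- **(3.23) p. 439 [PDF 29] — the summation over orderings and j-indices, PROVED**: *"the second is treated in the same way as the
expression (3.15): we sum over proper orderings and j-indices and we get (3.23)"*: with (2.6) for the two propagators at the level of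
kernels (`h0`, `h`), the sum over `0 ≤ j, j′ < j″` of the expressions (3.23) built on the pieces `(G^η_{(j)}(0), G^η_{(j′)})` is (3.23) with
`G^η_{j″}(0)`, `G^η_{j″}`. [cite: Balaban1983Higgs3, (3.23) p.439] -/
theorem expr323_resum (η : ℝ) (q : W →ₗ[ℝ] W) {j'' : ℕ} {G0 G : Kernel P j} {G0fam Gfam : ℕ → Kernel P j}
    (h0 : B3.Display26 G0 G0fam j'') (h : B3.Display26 G Gfam j'') (g g' : SiteField P j ℝ) (φ φ' : SiteField P j W) :
    ∑ i ∈ Finset.range j'', ∑ i' ∈ Finset.range j'', expr323 η q (G0fam i) (Gfam i') g g' φ φ' =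
      expr323 η q G0 G g g' φ φ' := by
  rw [expr323_sum_sum, ← h0, ← h]

end Eq323

/-! ## 4. (3.26), p. 440: "we sum with respect to j, j′, j″ from 0 to j₀ and we get the same expressions but with G_{j₀}(0)" -/

section Eq326

variable {ι κ : Type*} (s : Finset ι) (t : Finset κ)

/-- The kernel of the first graph of (3.26) is bilinear in its two propagators. [cite: Balaban1983Higgs3, (3.26) p.440] -/
theorem kerA_sum_sum (η τ : ℝ) (G : ι → Kernel P j) (G' : κ → Kernel P j) (μ μ' : Fin P.d) (x x' : Site P j) :
    kerA η τ (∑ i ∈ s, G i) (∑ i' ∈ t, G' i') μ μ' x x' = ∑ i ∈ s, ∑ i' ∈ t, kerA η τ (G i) (G' i') μ μ' x x' := by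
  simp only [kerA, dAdjKernel_finset_sum]
  rw [Finset.sum_mul_sum, Finset.mul_sum]
  exact Finset.sum_congr rfl fun i _ => Finset.mul_sum _ _ _

/-- The kernel of the second graph of (3.26) is bilinear in its two propagators. [cite: Balaban1983Higgs3, (3.26) p.440] -/
theorem kerB_sum_sum (η τ : ℝ) (G : ι → Kernel P j) (G' : κ → Kernel P j) (μ μ' : Fin P.d) (x x' : Site P j) :
    kerB η τ (∑ i ∈ s, G i) (∑ i' ∈ t, G' i') μ μ' x x' = ∑ i ∈ s, ∑ i' ∈ t, kerB η τ (G i) (G' i') μ μ' x x' := by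
  simp only [kerB, d2Kernel_finset_sum, sum_kernel_apply]
  rw [Finset.sum_mul_sum, Finset.mul_sum]
  exact Finset.sum_congr rfl fun i _ => Finset.mul_sum _ _ _

/-- The combined kernel of (3.26) is bilinear in its two propagators. [cite: Balaban1983Higgs3, (3.26) p.440] -/
theorem kerC_sum_sum (η τ : ℝ) (G : ι → Kernel P j) (G' : κ → Kernel P j) (μ μ' : Fin P.d) (x x' : Site P j) :
    kerC η τ (∑ i ∈ s, G i) (∑ i' ∈ t, G' i') μ μ' x x' = ∑ i ∈ s, ∑ i' ∈ t, kerC η τ (G i) (G' i') μ μ' x x' := by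
  simp only [kerC, kerA_sum_sum, kerB_sum_sum, ← Finset.sum_neg_distrib, ← Finset.sum_add_distrib]

/-- The two-leg pairing of (3.26) is additive in its kernel. [cite: Balaban1983Higgs3, (3.26) p.440] -/
theorem pairSum_kernel_sum (η : ℝ) (K : ι → Fin P.d → Fin P.d → Kernel P j) (g : SiteField P j ℝ) (A : VecField P j ℝ)
    (F : Fin P.d → Site P j → Site P j → ℝ) :
    pairSum η (fun μ μ' x x' => ∑ i ∈ s, K i μ μ' x x') g A F = ∑ i ∈ s, pairSum η (K i) g A F := by
  unfold pairSum
  rw [← sum2_mul_sum2_rot]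
  refine Finset.sum_congr rfl fun x _ => Finset.sum_congr rfl fun x' _ => ?_
  congr 1
  refine Finset.sum_congr rfl fun μ _ => Finset.sum_congr rfl fun μ' _ => ?_
  rw [Finset.mul_sum, Finset.sum_mul]

/-- kernel: the pairing of a doubly-indexed kernel sum is the double sum of the pairings. [cite: Balaban1983Higgs3, (3.26) p.440] -/
private theorem pairSum_kernel_sum_sum (η : ℝ) (K : ι → κ → Fin P.d → Fin P.d → Kernel P j) (g : SiteField P j ℝ)
    (A : VecField P j ℝ) (F : Fin P.d → Site P j → Site P j → ℝ) :
    pairSum η (fun μ μ' x x' => ∑ i ∈ s, ∑ i' ∈ t, K i i' μ μ' x x') g A F = ∑ i ∈ s, ∑ i' ∈ t, pairSum η (K i i') g A F := by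
  rw [pairSum_kernel_sum s η (fun i μ μ' x x' => ∑ i' ∈ t, K i i' μ μ' x x') g A F]
  exact Finset.sum_congr rfl fun i _ => pairSum_kernel_sum t η (K i) g A F

/-- The third (local) term of (3.26) is additive in its propagator. [cite: Balaban1983Higgs3, (3.26) p.440] -/
theorem term3_sum (η τ : ℝ) (G : ι → Kernel P j) (g g' : SiteField P j ℝ) (A A' : VecField P j ℝ) :
    term3 η τ (∑ i ∈ s, G i) g g' A A' = ∑ i ∈ s, term3 η τ (G i) g g' A A' := by
  unfold term3
  rw [← sum_mul_sum_rot]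
  refine Finset.sum_congr rfl fun x _ => ?_
  congr 1
  refine Finset.sum_congr rfl fun μ _ => ?_
  rw [sum_kernel_apply, Finset.mul_sum, Finset.mul_sum]

/-- The fourth (local) term of (3.26) is additive in its propagator. [cite: Balaban1983Higgs3, (3.26) p.440] -/
theorem term4_sum (η τ : ℝ) (G : ι → Kernel P j) (g g' : SiteField P j ℝ) (A A' : VecField P j ℝ) :
    term4 η τ (∑ i ∈ s, G i) g g' A A' = ∑ i ∈ s, term4 η τ (G i) g g' A A' := by
  unfold term4
  rw [← sum_mul_sum_rot]
  refine Finset.sum_congr rfl fun x _ => ?_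
  congr 1
  refine Finset.sum_congr rfl fun μ _ => ?_
  rw [dAdjKernel_finset_sum, Finset.mul_sum, Finset.mul_sum, Finset.mul_sum]

/-- kernel: the two nonlocal graphs of (3.26) with summed propagators are the double sums of the graphs, for any reading `F` of the
second leg. [cite: Balaban1983Higgs3, (3.26) p.440] -/
private theorem nonlocal326_sum_sum (η τ : ℝ) (G : ι → Kernel P j) (G' : κ → Kernel P j) (g : SiteField P j ℝ)
    (A : VecField P j ℝ) (F : Fin P.d → Site P j → Site P j → ℝ) :
    -pairSum η (kerA η τ (∑ i ∈ s, G i) (∑ i' ∈ t, G' i')) g A F + pairSum η (kerB η τ (∑ i ∈ s, G i) (∑ i' ∈ t, G' i')) g A F =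
      ∑ i ∈ s, ∑ i' ∈ t, (-pairSum η (kerA η τ (G i) (G' i')) g A F + pairSum η (kerB η τ (G i) (G' i')) g A F) := by
  have hA : kerA η τ (∑ i ∈ s, G i) (∑ i' ∈ t, G' i') = fun μ μ' x x' => ∑ i ∈ s, ∑ i' ∈ t, kerA η τ (G i) (G' i') μ μ' x x' :=
    funext fun μ => funext fun μ' => funext fun x => funext fun x' => kerA_sum_sum s t η τ G G' μ μ' x x'
  have hB : kerB η τ (∑ i ∈ s, G i) (∑ i' ∈ t, G' i') = fun μ μ' x x' => ∑ i ∈ s, ∑ i' ∈ t, kerB η τ (G i) (G' i') μ μ' x x' :=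
    funext fun μ => funext fun μ' => funext fun x => funext fun x' => kerB_sum_sum s t η τ G G' μ μ' x x'
  rw [hA, hB, pairSum_kernel_sum_sum, pairSum_kernel_sum_sum]
  simp only [Finset.sum_add_distrib, Finset.sum_neg_distrib]

/-- **p. 440 [PDF 30] — the resummation of (3.26), PROVED for its square bracket**: *"If j₀ denotes a smallest j-index of external
legs, then we sum with respect to j, j′, j″ from 0 to j₀ and we get the same expressions but with the propagator G_{j₀}(0)"*: with (2.6)
`G^η_{j₀}(0) = Σ_{j<j₀}G^η_{(j)}(0)` at the level of kernels (`h`), the two-line graphs of the square bracket of (3.26) summed over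
`0 ≤ j, j′ < j₀` plus the two one-line (local) graphs summed over `0 ≤ j″ < j₀` give the square bracket with all propagators `G^η_{j₀}(0)`.
[cite: Balaban1983Higgs3, (3.26) p.440] -/
theorem bracket326_resum (η τ : ℝ) {j0 : ℕ} {G : Kernel P j} {Gfam : ℕ → Kernel P j} (h : B3.Display26 G Gfam j0)
    (g g' : SiteField P j ℝ) (A A' : VecField P j ℝ) :
    (∑ i ∈ Finset.range j0, ∑ i' ∈ Finset.range j0,
        (-pairSum η (kerA η τ (Gfam i) (Gfam i')) g A (legNear g' A') + pairSum η (kerB η τ (Gfam i) (Gfam i')) g A (legNear g' A')))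
      - ∑ i'' ∈ Finset.range j0, (term3 η τ (Gfam i'') g g' A A' + term4 η τ (Gfam i'') g g' A A') =
      bracket326 η τ G G G g g' A A' := by
  rw [bracket326, h, nonlocal326_sum_sum, term3_sum, term4_sum, Finset.sum_add_distrib]
  ring

/-- **p. 440 — the same resummation for the LEFT SIDE of (3.26)** (the four graphs of (3.25) with the nonlocal leg g′(x′)A′_{μ′}(x′)):
summing the two-line graphs over `0 ≤ j, j′ < j₀` and the two local graphs over `0 ≤ j″ < j₀` gives the left side of (3.26) with all
propagators `G^η_{j₀}(0)`. [cite: Balaban1983Higgs3, (3.26) p.440] -/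
theorem lhs326_resum (η τ : ℝ) {j0 : ℕ} {G : Kernel P j} {Gfam : ℕ → Kernel P j} (h : B3.Display26 G Gfam j0)
    (g g' : SiteField P j ℝ) (A A' : VecField P j ℝ) :
    (∑ i ∈ Finset.range j0, ∑ i' ∈ Finset.range j0,
        (-pairSum η (kerA η τ (Gfam i) (Gfam i')) g A (legFar g' A') + pairSum η (kerB η τ (Gfam i) (Gfam i')) g A (legFar g' A')))
      - ∑ i'' ∈ Finset.range j0, (term3 η τ (Gfam i'') g g' A A' + term4 η τ (Gfam i'') g g' A A') =
      lhs326 η τ G G G g g' A A' := by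
  rw [lhs326, h, nonlocal326_sum_sum, term3_sum, term4_sum, Finset.sum_add_distrib]
  ring

/-- **p. 440 — the resummation at the level of the vacuum-polarization kernel `Π^{(η,j₀)}_{μμ′}(x)`** (r15's `Pi2`, *"The expression in
the square bracket on the right side of (3.26) has the form Σ_xη^dΣ g(x)A_μ(x)Π^{(η,j₀)}_{μμ′}(x)g′(x)A′_{μ′}(x)"*): the nonlocal part of
`Π` summed over `0 ≤ j, j′ < j₀` and its two local parts summed over `0 ≤ j″ < j₀` give `Π^{(η,j₀)}_{μμ′}` with the propagator `G^η_{j₀}(0)`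
in all three slots. [cite: Balaban1983Higgs3, (3.26) p.440] -/
theorem Pi2_resum (η τ : ℝ) {j0 : ℕ} {G : Kernel P j} {Gfam : ℕ → Kernel P j} (h : B3.Display26 G Gfam j0)
    (μ μ' : Fin P.d) (x : Site P j) :
    (∑ i ∈ Finset.range j0, ∑ i' ∈ Finset.range j0, ∑ x' : Site P j, η ^ P.d * kerC η τ (Gfam i) (Gfam i') μ μ' x x')
      - ∑ i'' ∈ Finset.range j0, ((if μ = μ' then τ * Gfam i'' x x else 0)
          + (if μ = μ' then τ * (η * dAdjKernel η⁻¹ μ (Gfam i'') x x) else 0)) =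
      Pi2 η τ G G G μ μ' x := by
  have h1 : ∑ x' : Site P j, η ^ P.d * kerC η τ G G μ μ' x x' =
      ∑ i ∈ Finset.range j0, ∑ i' ∈ Finset.range j0, ∑ x' : Site P j, η ^ P.d * kerC η τ (Gfam i) (Gfam i') μ μ' x x' := by
    rw [← sum_rot3 Finset.univ (Finset.range j0) (Finset.range j0), h]
    refine Finset.sum_congr rfl fun x' _ => ?_
    rw [kerC_sum_sum, Finset.mul_sum]
    exact Finset.sum_congr rfl fun i _ => Finset.mul_sum _ _ _
  have h3 : (if μ = μ' then τ * G x x else 0) = ∑ i ∈ Finset.range j0, (if μ = μ' then τ * Gfam i x x else 0) := by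
    rw [h, sum_kernel_apply, Finset.mul_sum]
    split_ifs <;> simp
  have h4 : (if μ = μ' then τ * (η * dAdjKernel η⁻¹ μ G x x) else 0) =
      ∑ i ∈ Finset.range j0, (if μ = μ' then τ * (η * dAdjKernel η⁻¹ μ (Gfam i) x x) else 0) := by
    rw [h, dAdjKernel_finset_sum, Finset.mul_sum, Finset.mul_sum]
    split_ifs <;> simp
  rw [Pi2, h1, h3, h4, Finset.sum_add_distrib]
  ring

/-- **p. 441 — the resummation for `Π^{(η,j₀)}_{μμ′ν}(x)`** (r15's `Pi3`, the kernel of the first curly bracket of (3.26), two-line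
graphs only): the double sum over `0 ≤ j, j′ < j₀` gives `Π^{(η,j₀)}_{μμ′ν}` with the propagator `G^η_{j₀}(0)` in both slots.
[cite: Balaban1983Higgs3, (3.26) p.441] -/
theorem Pi3_resum (η τ : ℝ) {j0 : ℕ} {G : Kernel P j} {Gfam : ℕ → Kernel P j} (h : B3.Display26 G Gfam j0)
    (dx : Fin P.d → Site P j → Site P j → ℝ) (μ μ' ν : Fin P.d) (x : Site P j) :
    ∑ i ∈ Finset.range j0, ∑ i' ∈ Finset.range j0, Pi3 η τ (Gfam i) (Gfam i') dx μ μ' ν x = Pi3 η τ G G dx μ μ' ν x := by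
  unfold Pi3
  rw [← sum_rot3 Finset.univ (Finset.range j0) (Finset.range j0), h]
  refine Finset.sum_congr rfl fun x' _ => ?_
  rw [kerC_sum_sum, Finset.sum_mul, Finset.mul_sum]
  exact Finset.sum_congr rfl fun i _ => by rw [Finset.sum_mul, Finset.mul_sum]

/-- **p. 440/441 — the resummation for the FIRST CURLY BRACKET of (3.26)** (two-line graphs only): the double sum over
`0 ≤ j, j′ < j₀` gives the curly bracket with `G^η_{j₀}(0)` in both slots. [cite: Balaban1983Higgs3, (3.26) p.440] -/
theorem curly1_resum (η τ : ℝ) {j0 : ℕ} {G : Kernel P j} {Gfam : ℕ → Kernel P j} (h : B3.Display26 G Gfam j0)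
    (g : SiteField P j ℝ) (A : VecField P j ℝ) (dx : Fin P.d → Site P j → Site P j → ℝ)
    (D : Fin P.d → Fin P.d → SiteField P j ℝ) :
    ∑ i ∈ Finset.range j0, ∑ i' ∈ Finset.range j0, curly1 η τ (Gfam i) (Gfam i') g A dx D = curly1 η τ G G g A dx D := by
  unfold curly1
  rw [← sum_rot3 Finset.univ (Finset.range j0) (Finset.range j0), h]
  refine Finset.sum_congr rfl fun ν _ => ?_
  have hK : (fun μ μ' x x' =>
        kerC η τ (∑ i ∈ Finset.range j0, Gfam i) (∑ i' ∈ Finset.range j0, Gfam i') μ μ' x x' * dx ν x x') =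
      fun μ μ' x x' => ∑ i ∈ Finset.range j0, ∑ i' ∈ Finset.range j0, kerC η τ (Gfam i) (Gfam i') μ μ' x x' * dx ν x x' := by
    funext μ μ' x x'
    rw [kerC_sum_sum, Finset.sum_mul]
    exact Finset.sum_congr rfl fun i _ => Finset.sum_mul _ _ _
  rw [hK, pairSum_kernel_sum_sum]

/-- **p. 440 — the resummation for the LAST CURLY BRACKET of (3.26)** (two-line graphs only, remainder leg `R`): the double sum over
`0 ≤ j, j′ < j₀` gives the curly bracket with `G^η_{j₀}(0)` in both slots. [cite: Balaban1983Higgs3, (3.26) p.440] -/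
theorem curly2_resum (η τ : ℝ) {j0 : ℕ} {G : Kernel P j} {Gfam : ℕ → Kernel P j} (h : B3.Display26 G Gfam j0)
    (g : SiteField P j ℝ) (A : VecField P j ℝ) (R : Fin P.d → Site P j → Site P j → ℝ) :
    ∑ i ∈ Finset.range j0, ∑ i' ∈ Finset.range j0, curly2 η τ (Gfam i) (Gfam i') g A R = curly2 η τ G G g A R := by
  unfold curly2
  have hK : kerC η τ (∑ i ∈ Finset.range j0, Gfam i) (∑ i' ∈ Finset.range j0, Gfam i') =
      fun μ μ' x x' => ∑ i ∈ Finset.range j0, ∑ i' ∈ Finset.range j0, kerC η τ (Gfam i) (Gfam i') μ μ' x x' :=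
    funext fun μ => funext fun μ' => funext fun x => funext fun x' => kerC_sum_sum _ _ η τ Gfam Gfam μ μ' x x'
  rw [h, hK, pairSum_kernel_sum_sum]

end Eq326

end

end Literature.MathematicalPhysics.QuantumFieldTheory.Balaban1983to89.B3Resummation315
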